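import Summits.FinalStateConjecture.FinalStateConjecture.Theorems.SwallowTheDatumUniversalWitnessFamilyStubModelData
import Literature.Geometry.Lorentzian.EndCompactificationData
import HarnessLib

/-!
# `ParametricKerrBurial`, line `receding-annulus-universal-collar` — stub `stub_bulkDatum` (BK2):
# the conformally flat multi-puncture (Brill–Lindquist) bulk datum

The registered stub `stub_bulkDatum` of crux `stmt-FinalStateConjecture-10052`
(`Summit.FinalStateConjecture.FinalStateConjecture.Theses.SwallowTheDatum.ParametricKerrBurial`), proved.
For `A > 0`, punctures `c_j ∈ ℝ³` with weights `α_j > 0` and radii `s_j > 0` (`j = 0, …, N`) there is a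
smooth TIME-SYMMETRIC datum `B = (W⁴ δ, 0)` on `E3 = ℝ³` whose coefficient field `B.coordH` IS the
Brill–Lindquist field `(A + Σ_j α_j/‖y − c_j‖)⁴ δ` (Brill–Lindquist, Phys. Rev. 131 (1963) 471, §II)
on the open set `U = {y | ∀ j, s_j/2 < ‖y − c_j‖}` off the half-balls about the punctures, and which
solves the vacuum constraints at every point of `U`.

Construction. The conformal factor `ψ = A + Σ_j α_j/‖y − c_j‖` has its `N + 1` punctures SMOOTHED
inside the balls `B(c_j, s_j/2)`:

  `W(y) = A + Σ_j α_j φ_j(y − c_j)`,  `φ_j(z) = (1 − S(4 − ‖z‖²/(s_j/4)²)) ‖z‖⁻¹`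

(`S = Real.smoothTransition`; `φ_j` is `C^∞` on all of `ℝ³`, `≥ 0`, and `= ‖z‖⁻¹` for `‖z‖ ≥ s_j/2`;
the one-puncture version is `ModelData.exists_smoothedInvRadius` of the sibling crux 10051), so that
`W` is `C^∞` on `ℝ³`, positive, `= ψ` on `U` and harmonic there; the datum with coefficient fields
`(W⁴ δ, 0)` exists by `exists_initialDataSet_of_contDiff`. Vacuum on `U`: the LOCAL MODEL is the
conformally flat datum `conformallyFlatData U W = (W⁴ δ, 0)` on the open set `U` (Bray's cap-chart
pattern, `EndCompactificationData`), which is time-symmetric, so its constraints reduce to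
`R(W⁴ δ) = 0` (`InitialDataSet.isVacuumConstraintSolution_iff_of_isTimeSymmetric`), and
`R(W⁴ δ) = −8 W⁻⁵ ΔW = 0` (`OpensChart.scalarCurvature_conformal_fourth_power`; `Δ‖· − c‖⁻¹ = 0` off
`c` is the translate of `Schwarzschild.exists_hasFDerivAt_fderiv_conformalFactor`, and the Laplacian
is additive); the constraints at a point of `U` transfer from the local model to `B`
(`ModelData.vacAt_of_localModel`: locality and naturality of the constraint map under `U ↪ ℝ³`,
Bartnik–Isenberg 2004, §2).

* §1 `BulkDatum.exists_smoothedInvRadius` — the smoothed inverse radius at scale `ρ > 0`;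
* §2 `BulkDatum.exists_hasFDerivAt_fderiv_invNorm_sub` — `w ↦ ‖w − c‖⁻¹` is harmonic off `c`;
* §3 `BulkDatum.exists_bulkProfile` — the smoothed factor `W` (smooth, positive, `= ψ` and harmonic
  on `U`);
* §4 `BulkDatum.conformallyFlatData_isVacuum_of_harmonic` — `(W⁴ δ, 0)` with `ΔW = 0` is vacuum;
* §5 `BulkDatum.exists_bulkDatum`, §6 `stub_bulkDatum` — the datum and the registered stub.

References: D. R. Brill, R. W. Lindquist, Phys. Rev. 131 (1963) 471–476, §II; R. Bartnik,
J. Isenberg, *The constraint equations* (2004), §2, §4.1 (time-symmetric conformally flat data: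
the Lichnerowicz equation reduces to `Δψ = 0`); J. Corvino, Comm. Math. Phys. 214 (2000), §4
(cut-off smoothing); C. W. Misner, K. S. Thorne, J. A. Wheeler, *Gravitation* (1973), §31.7.
-/

-- the doubled `FinalStateConjecture` path component is the summit/problem naming scheme, not a mistake
set_option linter.dupNamespace false
-- instance search through the nested operator type `E3 →L[ℝ] E3 →L[ℝ] ℝ` (`ContDiff.smul`, second derivatives)
set_option maxSynthPendingDepth 3

noncomputable section

namespace Summit.FinalStateConjecture.FinalStateConjecture.Theorems.SwallowTheDatum.ParametricKerrBurial

open scoped Manifold ContDiff Topology BigOperators InnerProductSpace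
open Bundle Set Filter Function MeasureTheory Literature.Geometry.Lorentzian
open Literature.Geometry.Lorentzian.MaoOhTao Literature.Geometry.Lorentzian.InitialDataSet
open TopologicalSpace (Opens)
open Literature.Geometry.Lorentzian.OpensChart (scalarCurvature_conformal_fourth_power)
open Summit.FinalStateConjecture.FinalStateConjecture.Theorems.SwallowTheDatum.UniversalWitnessFamily.ModelData
  (vacAt_of_localModel)

namespace BulkDatum

/-! ## §1 A smoothed inverse radius at scale `ρ` -/

/-- **A smoothed inverse radius at scale `ρ > 0`.** There is a `C^∞` function `φ ≥ 0` on `E3` with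
`φ(y) = ‖y‖⁻¹` for `‖y‖ ≥ ρ`: `φ = (1 − χ) ‖·‖⁻¹` with the cut-off `χ(y) = S(4 − ‖y‖²/(ρ/2)²)`
(`= 1` near the closed ball `‖y‖ ≤ ρ/2`, where `φ` therefore vanishes identically; `= 0` beyond
radius `ρ`; `0 ≤ χ ≤ 1`). Corvino 2000, §4 (cut-off functions). [cite: Corvino2000, §4] -/
theorem exists_smoothedInvRadius (ρ : ℝ) (hρ : 0 < ρ) :
    ∃ φ : E3 → ℝ, ContDiff ℝ ∞ φ ∧ (∀ y, 0 ≤ φ y) ∧ ∀ y : E3, ρ ≤ ‖y‖ → φ y = ‖y‖⁻¹ := by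
  -- adapted from `ModelData.exists_smoothedInvRadius` (Theorems/SwallowTheDatumUniversalWitnessFamilyStubModelData)
  have hρ2 : (0 : ℝ) < ρ / 2 := half_pos hρ
  refine ⟨fun y ↦ (1 - Real.smoothTransition (4 - ‖y‖ ^ 2 / (ρ / 2) ^ 2)) * ‖y‖⁻¹,
    contDiff_iff_contDiffAt.2 fun y ↦ ?_, fun y ↦ ?_, fun y hy ↦ ?_⟩
  · by_cases hy : ρ / 2 < ‖y‖
    · have hy0 : y ≠ 0 := norm_pos_iff.1 (hρ2.trans hy)
      exact (contDiff_const.sub (contDiff_cutoff (ρ / 2))).contDiffAt.mul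
        ((contDiffAt_norm ℝ hy0).inv (norm_ne_zero_iff.2 hy0))
    · refine (contDiffAt_const (c := (0 : ℝ))).congr_of_eventuallyEq ?_
      have hy' : ‖y‖ < 3 / 2 * (ρ / 2) := by linarith [not_lt.1 hy]
      filter_upwards [(isOpen_lt continuous_norm continuous_const).mem_nhds hy'] with z hz
      rw [cutoff_eq_one hρ2 hz, sub_self, zero_mul]
  · exact mul_nonneg (sub_nonneg.2 (Real.smoothTransition.le_one _)) (inv_nonneg.2 (norm_nonneg _))
  · have hy2 : 2 * (ρ / 2) ≤ ‖y‖ := by linarith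
    change (1 - Real.smoothTransition (4 - ‖y‖ ^ 2 / (ρ / 2) ^ 2)) * ‖y‖⁻¹ = ‖y‖⁻¹
    rw [cutoff_eq_zero hρ2 hy2, sub_zero, one_mul]

/-! ## §2 The inverse distance to a point is harmonic off the point -/

/-- `‖z‖⁻¹ = ψ₂(z) − 1` for Schwarzschild's conformal factor `ψ_M(z) = 1 + M/(2‖z‖)` at `M = 2`
(also at `z = 0`, where both sides vanish). [folklore] -/
theorem invNorm_eq_conformalFactor_two_sub_one (z : E3) :
    ‖z‖⁻¹ = Schwarzschild.conformalFactor 2 z - 1 := by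
  rw [Schwarzschild.conformalFactor_apply, add_sub_cancel_left, ← div_div, div_self (two_ne_zero' ℝ),
    one_div]

/-- The differential of `z ↦ ‖z‖⁻¹` is that of `ψ₂` (they differ by the constant `1`). [folklore] -/
theorem fderiv_invNorm_eq :
    fderiv ℝ (fun z : E3 ↦ ‖z‖⁻¹) = fderiv ℝ (Schwarzschild.conformalFactor 2) := by
  rw [show (fun z : E3 ↦ ‖z‖⁻¹) = fun z ↦ Schwarzschild.conformalFactor 2 z - 1 from
    funext invNorm_eq_conformalFactor_two_sub_one]
  funext z
  exact fderiv_sub_const 1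

/-- **`w ↦ ‖w − c‖⁻¹` is harmonic off `c`**, in the form consumed by
`OpensChart.scalarCurvature_conformal_fourth_power`: for `y ≠ c` the differential of `w ↦ ‖w − c‖⁻¹`
has a derivative `F'` at `y` with `∑ᵢ F'(eᵢ, eᵢ) = 0` in an orthonormal basis — the translate by `c`
of `Schwarzschild.exists_hasFDerivAt_fderiv_conformalFactor` (`Δ(1/r) = 0` on `ℝ³ ∖ {0}`;
Bartnik–Isenberg 2004, §4.1). [cite: BartnikIsenberg2004, §4.1 (Lichnerowicz equation)] -/
theorem exists_hasFDerivAt_fderiv_invNorm_sub (c : E3) {y : E3} (hy : y ≠ c)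
    (ob : OrthonormalBasis (Fin 3) ℝ E3) :
    ∃ F' : E3 →L[ℝ] E3 →L[ℝ] ℝ,
      HasFDerivAt (fderiv ℝ (fun w : E3 ↦ ‖w - c‖⁻¹)) F' y ∧ ∑ i, F' (ob i) (ob i) = 0 := by
  obtain ⟨F', hF', hΔ⟩ :=
    Schwarzschild.exists_hasFDerivAt_fderiv_conformalFactor 2 (sub_ne_zero.2 hy) ob
  refine ⟨F', ?_, hΔ⟩
  have h : fderiv ℝ (fun w : E3 ↦ ‖w - c‖⁻¹) =
      fun w ↦ fderiv ℝ (Schwarzschild.conformalFactor 2) (w - c) := by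
    funext w
    rw [← fderiv_invNorm_eq]
    exact fderiv_comp_sub (f := fun z : E3 ↦ ‖z‖⁻¹) c
  rw [h]
  exact (hasFDerivAt_comp_sub (f := fderiv ℝ (Schwarzschild.conformalFactor 2)) c).2 hF'

/-! ## §3 The smoothed Brill–Lindquist conformal factor -/

/-- The set `{y | ∀ j, s_j/2 < ‖y − c_j‖}` off the half-balls about finitely many punctures is open.
[folklore] -/
theorem isOpen_offPunctures (N : ℕ) (c : Fin (N + 1) → E3) (s : Fin (N + 1) → ℝ) :
    IsOpen {y : E3 | ∀ j, s j / 2 < ‖y - c j‖} := by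
  rw [show {y : E3 | ∀ j, s j / 2 < ‖y - c j‖} = ⋂ j, {y : E3 | s j / 2 < ‖y - c j‖} by
    ext y; simp]
  exact isOpen_iInter_of_finite fun j ↦
    isOpen_lt continuous_const (continuous_id.sub continuous_const).norm

/-- **The smoothed Brill–Lindquist conformal factor.** For `A > 0`, punctures `c_j` with weights
`α_j > 0` and radii `s_j > 0` (`j = 0, …, N`) there is a `C^∞` function `W > 0` on `ℝ³` which EQUALS
the Brill–Lindquist factor `A + Σ_j α_j/‖y − c_j‖` on `U = {y | ∀ j, s_j/2 < ‖y − c_j‖}` and is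
harmonic there: `W = A + Σ_j α_j φ_j(· − c_j)` with the smoothed inverse radii `φ_j` at scale `s_j/2`
(`exists_smoothedInvRadius`); on `U` each `φ_j(· − c_j)` is `‖· − c_j‖⁻¹` near the point, whose
Laplacian vanishes (`exists_hasFDerivAt_fderiv_invNorm_sub`), and the Laplacian is additive.
Brill–Lindquist 1963, §II; Bartnik–Isenberg 2004, §4.1. [cite: BrillLindquist1963, §II] -/
theorem exists_bulkProfile (A : ℝ) (N : ℕ) (c : Fin (N + 1) → E3) (α s : Fin (N + 1) → ℝ)
    (hA : 0 < A) (hα : ∀ j, 0 < α j) (hs : ∀ j, 0 < s j) :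
    ∃ W : E3 → ℝ, ContDiff ℝ ∞ W ∧ (∀ y, 0 < W y) ∧
      (∀ y : E3, (∀ j, s j / 2 < ‖y - c j‖) → W y = A + ∑ j, α j / ‖y - c j‖) ∧
      ∀ y : E3, (∀ j, s j / 2 < ‖y - c j‖) → ∃ F' : E3 →L[ℝ] E3 →L[ℝ] ℝ,
        HasFDerivAt (fderiv ℝ W) F' y ∧
          ∑ i, F' (EuclideanSpace.basisFun (Fin 3) ℝ i) (EuclideanSpace.basisFun (Fin 3) ℝ i) = 0 := by
  choose φ hφs hφ0 hφfar using fun j ↦ exists_smoothedInvRadius (s j / 2) (half_pos (hs j))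
  -- the pieces `y ↦ φ_j (y − c_j)` and their differentials
  have hpiece : ∀ j, ContDiff ℝ ∞ fun y : E3 ↦ φ j (y - c j) := fun j ↦
    (hφs j).comp (contDiff_id.sub contDiff_const)
  have hpd : ∀ j y, HasFDerivAt (fun w : E3 ↦ φ j (w - c j))
      (fderiv ℝ (fun w : E3 ↦ φ j (w - c j)) y) y := fun j y ↦
    (((hpiece j).differentiable (by simp)) y).hasFDerivAt
  -- the profile and its differential
  have hderiv : ∀ y, HasFDerivAt (fun y : E3 ↦ A + ∑ j, α j * φ j (y - c j))
      (∑ j, α j • fderiv ℝ (fun w : E3 ↦ φ j (w - c j)) y) y := fun y ↦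
    (HasFDerivAt.fun_sum (u := Finset.univ) fun j _ ↦ (hpd j y).const_mul (α j)).const_add A
  have hfW : fderiv ℝ (fun y : E3 ↦ A + ∑ j, α j * φ j (y - c j)) =
      fun y ↦ ∑ j, α j • fderiv ℝ (fun w : E3 ↦ φ j (w - c j)) y :=
    funext fun y ↦ (hderiv y).fderiv
  refine ⟨fun y ↦ A + ∑ j, α j * φ j (y - c j),
    contDiff_const.add (ContDiff.sum fun j _ ↦ contDiff_const.mul (hpiece j)),
    fun y ↦ add_pos_of_pos_of_nonneg hA
      (Finset.sum_nonneg fun j _ ↦ mul_nonneg (hα j).le (hφ0 j _)),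
    fun y hy ↦ ?_, fun y hy ↦ ?_⟩
  · -- on `U` every piece is the inverse distance
    change A + ∑ j, α j * φ j (y - c j) = A + ∑ j, α j / ‖y - c j‖
    congr 1
    exact Finset.sum_congr rfl fun j _ ↦ by rw [hφfar j _ (hy j).le, div_eq_mul_inv]
  · -- harmonicity at `y ∈ U`
    have hne : ∀ j, y ≠ c j := fun j h ↦ by
      have h1 := hy j
      rw [h, sub_self, norm_zero] at h1
      linarith [hs j]
    choose F' hF' hΔ using fun j ↦
      exists_hasFDerivAt_fderiv_invNorm_sub (c j) (hne j) (EuclideanSpace.basisFun (Fin 3) ℝ)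
    -- near `y` the differential of each piece is that of the inverse distance
    have hloc : ∀ j, HasFDerivAt (fderiv ℝ (fun w : E3 ↦ φ j (w - c j))) (F' j) y := fun j ↦ by
      refine (hF' j).congr_of_eventuallyEq ?_
      have hV : ∀ᶠ w in 𝓝 y, s j / 2 < ‖w - c j‖ :=
        (isOpen_lt continuous_const (continuous_id.sub continuous_const).norm).mem_nhds (hy j)
      filter_upwards [hV] with w hw
      apply Filter.EventuallyEq.fderiv_eq
      have hV' : ∀ᶠ z in 𝓝 w, s j / 2 < ‖z - c j‖ :=
        (isOpen_lt continuous_const (continuous_id.sub continuous_const).norm).mem_nhds hw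
      filter_upwards [hV'] with z hz
      exact hφfar j _ hz.le
    refine ⟨∑ j, α j • F' j, ?_, ?_⟩
    · rw [hfW]
      exact HasFDerivAt.fun_sum fun j _ ↦ (hloc j).const_smul (α j)
    · -- the trace is additive
      simp only [_root_.sum_apply, _root_.smul_apply, smul_eq_mul]
      rw [Finset.sum_comm]
      exact Finset.sum_eq_zero fun j _ ↦ by rw [← Finset.mul_sum, hΔ j, mul_zero]

/-! ## §4 Conformally flat time-symmetric data with a harmonic factor are vacuum -/

/-- **Conformally flat time-symmetric data `(W⁴ δ, 0)` with `W` harmonic solve the vacuum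
constraints.** On an open `U ⊆ ℝ³`, if the smooth factor `W` is positive on `U` and harmonic there
(`∑ᵢ D²W(y)(eᵢ, eᵢ) = 0`), then `conformallyFlatData U W` is a vacuum constraint solution: `k = 0` kills
the momentum constraint and `|k|²`, `(tr k)²` (`isVacuumConstraintSolution_iff_of_isTimeSymmetric`), and
`R(W⁴ δ) = −8 W⁻⁵ ΔW = 0` (`OpensChart.scalarCurvature_conformal_fourth_power`). Bartnik–Isenberg 2004,
§4.1 (the Lichnerowicz equation with free data `(δ, 0, 0)` reduces to `Δψ = 0`); the pattern of
`Schwarzschild.conformalData_isVacuumConstraintSolution_holds`. [cite: BartnikIsenberg2004, §4.1 (Lichnerowicz equation)] -/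
theorem conformallyFlatData_isVacuum_of_harmonic (U : Opens E3) (W : E3 → ℝ) (hW : ContDiff ℝ ∞ W)
    (hpos : ∀ y : U, 0 < W y)
    (hharm : ∀ y : U, ∃ F' : E3 →L[ℝ] E3 →L[ℝ] ℝ, HasFDerivAt (fderiv ℝ W) F' y ∧
      ∑ i, F' (EuclideanSpace.basisFun (Fin 3) ℝ i) (EuclideanSpace.basisFun (Fin 3) ℝ i) = 0) :
    ∀ [(conformallyFlatData U W hW hpos).metric.HasLeviCivita],
      (conformallyFlatData U W hW hpos).IsVacuumConstraintSolution := by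
  intro _
  rw [InitialDataSet.isVacuumConstraintSolution_iff_of_isTimeSymmetric
    (conformallyFlatData_isTimeSymmetric U W hW hpos)]
  intro x
  obtain ⟨F', hF', hΔ⟩ := hharm x
  have h2 : (2 : ℕ∞ω) ≤ ∞ := WithTop.coe_le_coe.mpr le_top
  rw [scalarCurvature_conformal_fourth_power (g := (conformallyFlatData U W hW hpos).metric)
    (G := fun y ↦ W y ^ 4 • (innerSL ℝ : E3 →L[ℝ] E3 →L[ℝ] ℝ))
    (δ := (innerSL ℝ : E3 →L[ℝ] E3 →L[ℝ] ℝ)) (fun _ _ ↦ rfl) (fun _ ↦ rfl) h2 (fun _ ↦ rfl)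
    (EuclideanSpace.basisFun (Fin 3) ℝ) x (fun y ↦ (hpos y).ne')
    (fun y ↦ (hW.differentiable (by simp)).differentiableAt) hF', hΔ, mul_zero]

/-! ## §5 The bulk datum -/

/-- **The smoothed Brill–Lindquist bulk datum.** For `A > 0`, `α_j > 0`, `s_j > 0` there is a smooth
datum `B` on `ℝ³` with `k_B = 0` everywhere whose coefficient field is EXACTLY
`(A + Σ_j α_j/‖y − c_j‖)⁴ δ` on `U = {y | ∀ j, s_j/2 < ‖y − c_j‖}` and which satisfies the vacuum
constraints at every point of `U`: `B = (W⁴ δ, 0)` for the smoothed conformal factor `W` of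
`exists_bulkProfile` (`exists_initialDataSet_of_contDiff`; positive definite since `W > 0`); on `U` it
agrees with the local model `conformallyFlatData U W`, vacuum by
`conformallyFlatData_isVacuum_of_harmonic`, and the constraints at a point transfer
(`ModelData.vacAt_of_localModel`). Brill–Lindquist 1963, §II; Bartnik–Isenberg 2004, §2, §4.1.
[cite: BrillLindquist1963, §II] -/
theorem exists_bulkDatum (A : ℝ) (N : ℕ) (c : Fin (N + 1) → E3) (α s : Fin (N + 1) → ℝ)
    (hA : 0 < A) (hα : ∀ j, 0 < α j) (hs : ∀ j, 0 < s j) :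
    ∃ B : InitialDataSet (𝓡 3) E3, (∀ y : E3, B.k y = 0) ∧
      ∀ y : E3, (∀ j, s j / 2 < ‖y - c j‖) →
        B.coordH y = (A + ∑ j, α j / ‖y - c j‖) ^ 4 • (innerSL ℝ : E3 →L[ℝ] E3 →L[ℝ] ℝ) ∧
          VacAt B y := by
  obtain ⟨W, hWs, hWpos, hWU, hharm⟩ := exists_bulkProfile A N c α s hA hα hs
  -- the datum with coefficient fields `(W⁴ δ, 0)`
  have hg : ContDiff ℝ ∞ fun y : E3 ↦ W y ^ 4 • (innerSL ℝ : E3 →L[ℝ] E3 →L[ℝ] ℝ) :=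
    (hWs.pow 4).smul contDiff_const
  obtain ⟨B, hH, hK⟩ := exists_initialDataSet_of_contDiff
    (fun y : E3 ↦ W y ^ 4 • (innerSL ℝ : E3 →L[ℝ] E3 →L[ℝ] ℝ)) (fun _ ↦ 0) hg contDiff_const
    (fun y v w ↦ by
      change W y ^ 4 * ⟪v, w⟫_ℝ = W y ^ 4 * ⟪w, v⟫_ℝ
      rw [real_inner_comm])
    (fun y v hv ↦ by
      change 0 < W y ^ 4 * ⟪v, v⟫_ℝ
      exact mul_pos (pow_pos (hWpos y) 4) (real_inner_self_pos.2 hv))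
    (fun _ _ _ ↦ rfl)
  -- its sections
  have hBh : ∀ y v w : E3, B.h.inner y v w = W y ^ 4 * ⟪v, w⟫_ℝ := fun y v w ↦ by
    rw [← InitialDataSet.coordH_apply, hH]
    rfl
  have hBk : ∀ y : E3, B.k y = 0 := fun y ↦ congrFun hK y
  -- the local model `(W⁴ δ, 0)` on the open set `U` off the half-balls, vacuum since `ΔW = 0` there
  let U : Opens E3 := ⟨{y : E3 | ∀ j, s j / 2 < ‖y - c j‖}, isOpen_offPunctures N c s⟩
  have hposU : ∀ y : U, 0 < W y := fun y ↦ hWpos y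
  have hharmU : ∀ y : U, ∃ F' : E3 →L[ℝ] E3 →L[ℝ] ℝ, HasFDerivAt (fderiv ℝ W) F' y ∧
      ∑ i, F' (EuclideanSpace.basisFun (Fin 3) ℝ i) (EuclideanSpace.basisFun (Fin 3) ℝ i) = 0 :=
    fun y ↦ hharm y y.2
  refine ⟨B, hBk, fun y hy ↦ ⟨?_, ?_⟩⟩
  · -- the exact Brill–Lindquist field on `U`
    rw [show B.coordH y = W y ^ 4 • (innerSL ℝ : E3 →L[ℝ] E3 →L[ℝ] ℝ) from congrFun hH y, hWU y hy]
  · -- vacuum on `U`, transferred from the local model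
    exact vacAt_of_localModel B U (conformallyFlatData U W hWs hposU)
      (conformallyFlatData_isVacuum_of_harmonic U W hWs hposU hharmU)
      (fun u v w ↦ by rw [hBh, conformallyFlatData_h_inner]) (fun u v w ↦ by rw [hBk]; rfl) hy

end BulkDatum

/-! ## §6 The stub -/

/-- **Stub `stub_bulkDatum`** (registered signature, line `receding-annulus-universal-collar`, crux item
stmt-FinalStateConjecture-10052; brick BK2 of `stub_bulkAt`): the smoothed Brill–Lindquist bulk datum
`B = (W⁴ δ, 0)` on `ℝ³` — time-symmetric, exactly `((A + Σ_j α_j/‖y − c_j‖)⁴ δ, 0)` off the half-balls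
`B(c_j, s_j/2)` and vacuum there (`BulkDatum.exists_bulkDatum`). Brill–Lindquist 1963, §II;
Bartnik–Isenberg 2004, §2, §4.1. [cite: BrillLindquist1963, §II] -/
theorem stub_bulkDatum : ∀ (A : ℝ) (N : ℕ) (c : Fin (N + 1) → E3) (α s : Fin (N + 1) → ℝ),
    0 < A → (∀ j, 0 < α j) → (∀ j, 0 < s j) →
    ∃ B : InitialDataSet (𝓡 3) E3, (∀ y : E3, B.k y = 0) ∧
      ∀ y : E3, (∀ j, s j / 2 < ‖y - c j‖) →
        B.coordH y = (A + ∑ j, α j / ‖y - c j‖) ^ 4 • (innerSL ℝ : E3 →L[ℝ] E3 →L[ℝ] ℝ) ∧ VacAt B y :=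
  BulkDatum.exists_bulkDatum

end Summit.FinalStateConjecture.FinalStateConjecture.Theorems.SwallowTheDatum.ParametricKerrBurial

end
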